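import Literature.NumberTheory.Weil1964.UnitaryArchLocalCayleyWeightMassTwo   -- ★ `skewC`, `traceFormC`, `lieGramC`, `lieFinBasisC`, `lieGramDetC`, `lieStdLebesgueC(_eq_smul_addHaar)`, `mem_skewC_two_one`, `eq_of_mem_skewC_two_one`, `I_smul_one_mem_skewC_one`, `eq_im_smul_of_mem_skewC_one`
import HarnessLib

/-!
# K2 ∕ E5 «TamagawaUnitary» — FILE `K2E5LieGramDetValue` (1∕2): THE VALUE OF THE TRACE-FORM GRAM DETERMINANT OF `𝔲(J)` AT A COMPLEX PLACE
# (`N = 1`: `−1`; `N = 2`, definite `1₂`: `+4`; the indefinite `J₋ = diag(1, −1)`: `+4` is the companion file `K2E5LieGramDetValueIndefinite`) AND THE RESULTING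
# COORDINATE FORM OF THE TOP-FORM LEBESGUE MEASURE `λ_{𝔲(1)} = dt`, `λ_{𝔲(2)} = 2 · da db dz` — the Gram input of socket F9 `sig_K2E5BetaArchPinConstant` (E5 HANDOVER §6.6 RISK #3)

Cell `pub/hodgecm-mathlib`, Track B «K2-LIT», engine E5, crux H413 = `stmt-HodgeConjecture-24833`, route of record `route-HodgeConjecture-HCCMUnconditional`;
deal (c) of K2E3-plan (g1) 2026-09-03T23:27:26Z (successor E5 dealer; E5 HANDOVER `Lines/K2_E5_TamagawaUnitary_Sigs_TABLE.md` ED. 5 §6.6 RISK #3 «arch constant F9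
(power of 2, Gram determinant ★ `lieGramDet_ne_zero`)»); prover seat hodgecm-mathlib-K2E5-p22 (g2).  THEOREMS ONLY (no `def`, no `instance`, no `notation`, no
named-fact hypothesis, no `sorry`); imports = ★ Literature + HarnessLib; lane `--supports stmt-HodgeConjecture-24833 --as helper`.

THE CAVEAT THE SOCKET MUST RESPECT (★ census, K2 bus REPORT-FIRST 23:30Z).  ★ `Weil1964.UnitaryArchTopForm.lieGramDet F E c N J` (global, `UnitaryArchTopFormHaar.lean`
:130) and its one-place twin ★ `Weil1964.UnitaryArchLocalTopForm.lieGramDetC N Jw` (`UnitaryArchLocalTopFormHaar.lean` :107) are the determinants of the trace form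
`β(X, Y) = Re tr(XY)` in the BASIS OF RECORD `Module.finBasis` — a `Classical.choice` basis: under a change of basis `P` a Gram determinant becomes `det(P)² · det`
(★ `lieGramC_basis_change`), so only its SIGN and its NON-VANISHING (★ `lieGramDet_ne_zero`, ★ `lieGramDetC_ne_zero_of_conjTranspose_eq`) are intrinsic — `|lieGramDet|`
has no closed form (§1: `lieGramDetC = c² · det Gram(B)` for every basis `B`, `c ≠ 0`).  The intrinsic object is the top-form Lebesgue measure ★ `lieStdLebesgueC N Jw =
ofReal √|det Gram(B)| • B.addHaar` for EVERY basis `B` (★ `lieStdLebesgueC_eq_smul_addHaar`), and THE VALUE asked for is the Gram determinant of the matrix-entry COORDINATE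
bases, equivalently the constant in `λ = 2^{N(N−1)∕2} · (matrix-entry Lebesgue)`:

| `N` | `Jw` | coordinate family | Gram `Re tr(E_i E_j)` | det | `λ = lieStdLebesgueC N Jw` |
|---|---|---|---|---|---|
| 1 | any invertible `1 × 1` | `i·1` | `(−1)` | `−1` | `dt` along `t ↦ t·(i·1)` (§2) |
| 2 | `1₂` (definite) | `diag(i,0), diag(0,i), !![0,1;−1,0], !![0,i;i,0]` | `diag(−1,−1,−2,−2)` | `+4` | `2 · da db dz` along `(a,b,z) ↦ !![ia, z; −z̄, ib]` (§3) |
| 2 | `J₋ = diag(1,−1)` (indefinite) | `diag(i,0), diag(0,i), !![0,1;1,0], !![0,i;−i,0]` | `diag(−1,−1,+2,+2)` | `+4` | `2 · da db dz` along `(a,b,z) ↦ !![ia, z; z̄, ib]` (companion file) |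

so the intrinsic signs are `lieGramDetC 1 Jw < 0`, `0 < lieGramDetC 2 1₂`, `0 < lieGramDetC 2 J₋` ((−1)^N, the number of negative directions being `p² + q² ≡ N`), and the
Gram input to F9 is the factor `2` per complex place for `𝔲(h)_w` (BOTH signatures) against `1` for `𝔲(1)_w` — globally `2^d`, `d = [L : ℚ]∕2` (★ `skewPiEquiv` ∕
★ `map_archPiEquiv_archTopFormHaar_of` make the per-place statement the natural currency; every `2 × 2` hermitian `h_w` is congruent to `1₂`, `−1₂` (same `𝔲`) or `J₋`,
transported by ★ `UnitaryArchLocalSkewCongr` ∕ ★ `exists_formMul_equiv_map_lieStdLebesgueC`).  The `N = 1` and `N = 2, 1₂` computations already sit INSIDE the proofs of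
★ `lintegral_cayleyWeightC_one` ∕ ★ `lintegral_cayleyWeightC_two` (as `have`s, not exported); this file exports them as theorems and adds the indefinite form `J₋`.

CONTENTS.
* §1 (any `N`, `Jw`) `det_lieGramC_eq_sq_mul` (`det Gram(v) = det(P)²·det Gram(B)`), **`exists_lieGramDetC_eq_sq_mul`** (`lieGramDetC = c²·det Gram(B)`, `c ≠ 0`),
  `lieGramDetC_pos_iff`, `lieGramDetC_neg_iff` (the sign is read off ANY basis).
* §2 (`N = 1`) `traceFormC_I_smul_one` (`= −1`), **`lieGramDetC_one_neg`**, **`lieStdLebesgueC_one_eq_map`** (`λ = (t ↦ t·(i·1))_* dt`).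
* §3 (`N = 2`, `Jw = 1₂`) `traceFormC_coord_two_one` (`β` in coordinates `= −(aa′ + bb′ + 2 Re(z z̄′))`), **`lieGramDetC_two_one_pos`**, **`lieStdLebesgueC_two_one_eq`**
  (`λ = 2 · ψ_*(da db dz)`).
* companion file `Theorems/K2E5LieGramDetValueIndefinite.lean` (`N = 2`, `Jw = J₋`): `mem_skewC_two_diag`, `eq_of_mem_skewC_two_diag`, `traceFormC_coord_two_diag`,
  `lieGramDetC_two_diag_pos`, `lieStdLebesgueC_two_diag_eq` (`λ = 2 · ψ₋_*(da db dz)`) — split off for the 400-line rule.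

HONEST LABEL.  HC_CM is proved only modulo the 7 printed citations (2 remaining named inputs: hLiu418 = `stmt-HodgeConjecture-24832`, h413 = `stmt-HodgeConjecture-24833`)
until rung 0 closes; this file moves no counter — it pins one normalisation constant that socket F9 (unit F, S3's arch half of G0-loc) needs to be typed with an explicit value.

## References
* [Macdonald1980] I. G. Macdonald, *The volume of a compact Lie group*, Invent. Math. 56 (1980), 93–95 (the trace-form normalisation `λ = |ω_std|`; `vol U(n)`).
* [Rogawski1990] J. D. Rogawski, *Automorphic Representations of Unitary Groups in Three Variables*, Ann. of Math. Stud. 123 (1990), §1.7 p. 6 (compatible measures `dg = |Ω|_v`).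
* [Knapp2002] A. W. Knapp, *Lie Groups Beyond an Introduction*, 2nd ed., Birkhäuser (2002), I §1 (the real forms `𝔲(p,q)`), VIII §2.
* [Helgason2000] S. Helgason, *Groups and Geometric Analysis*, AMS (2000), Introduction §4 (`SU(1,1)`), Ch. I §1 Thm. 1.14.
* Tree: `Literature/NumberTheory/Weil1964/{UnitaryArchLocalCayleyChart, UnitaryArchLocalTopFormHaar, UnitaryArchLocalCayleyWeightMassOne, UnitaryArchLocalCayleyWeightMassTwo,
  UnitaryArchTopFormDiscConstant, UnitaryArchLocalSkewCongr, UnitaryArchTopFormHaar, UnitaryArchTopFormHaarCM, UnitaryArchTopFormHaarProductPlaces}.lean`.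
-/

set_option autoImplicit false
-- the mandated namespace repeats the single-problem summit's segment (`HodgeConjecture.HodgeConjecture`)
set_option linter.dupNamespace false
-- submodule-normed vs subtype topologies on `↥(skewC …)` under the `[BorelSpace ↥(skewC …)]` binder (as in the ★ `UnitaryArchLocal*` files)
set_option backward.isDefEq.respectTransparency false

noncomputable section

open Set MeasureTheory MeasureTheory.Measure Module Matrix Complex
open scoped Classical Matrix Matrix.Norms.Operator MatrixGroups ENNReal NNReal Pointwise ComplexConjugate
open Literature.NumberTheory.Weil1964.UnitaryArchLocalTopForm

namespace Summit.HodgeConjecture.HodgeConjecture.Cruxes.H413.K2E5LieGramDetValue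

/-! ## §1 The Gram determinant of the basis of record, modulo squares: `lieGramDetC = c² · det Gram(B)` -/

section Generic

variable {N : ℕ} {Jw : Matrix (Fin N) (Fin N) ℂ}

/-- **Change of basis for the Gram determinant**: for a basis `B` of `𝔲(Jw)` and any family `v`, `det Gram(v) = det(P)² · det Gram(B)`, `P = B.toMatrix v`
(★ `lieGramC_basis_change`). [cite: Macdonald1980, p. 93] -/
theorem det_lieGramC_eq_sq_mul {ι : Type} [Fintype ι] [DecidableEq ι] (B : Basis ι ℝ (skewC N Jw)) (v : ι → skewC N Jw) :
    (lieGramC v).det = (B.toMatrix v).det ^ 2 * (lieGramC B).det := by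
  rw [lieGramC_basis_change B v, Matrix.det_mul, Matrix.det_mul, Matrix.det_transpose]
  ring

/-- **THE GRAM DETERMINANT OF RECORD, MODULO SQUARES**: for EVERY basis `B` of `𝔲(Jw)` there is `c ≠ 0` with `lieGramDetC N Jw = c² · det Gram(B)` — the basis of record
★ `lieFinBasisC` is a choice basis, so this (sign and non-vanishing, not the magnitude) is all that `lieGramDetC` determines. [cite: Macdonald1980, p. 93] [cite: Knapp2002, VIII §2] -/
theorem exists_lieGramDetC_eq_sq_mul {ι : Type} [Fintype ι] [DecidableEq ι] (B : Basis ι ℝ (skewC N Jw)) :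
    ∃ c : ℝ, c ≠ 0 ∧ lieGramDetC N Jw = c ^ 2 * (lieGramC B).det := by
  haveI : FiniteDimensional ℝ (Matrix (Fin N) (Fin N) ℂ) := finiteDimensional_matrixC
  set B₀ := lieFinBasisC N Jw with hB₀
  let e : ι ≃ Fin (Module.finrank ℝ (skewC N Jw)) := B.indexEquiv B₀
  set B₁ : Basis (Fin (Module.finrank ℝ (skewC N Jw))) ℝ (skewC N Jw) := B.reindex e with hB₁
  have hG : (lieGramC B₁).det = (lieGramC B).det := by
    have h1 : lieGramC B₁ = Matrix.reindex e e (lieGramC B) := by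
      ext i j
      simp only [lieGramC_apply, hB₁, Module.Basis.reindex_apply, Matrix.reindex_apply, Matrix.submatrix_apply]
    rw [h1, Matrix.det_reindex_self]
  refine ⟨(B₁.toMatrix B₀).det, ?_, ?_⟩
  · rw [← Module.Basis.det_apply]
    exact (B₁.isUnit_det B₀).ne_zero
  · rw [← hG]
    exact det_lieGramC_eq_sq_mul B₁ B₀

/-- The SIGN of the Gram determinant of record is read off any basis: `0 < lieGramDetC ↔ 0 < det Gram(B)`. [cite: Knapp2002, VIII §2] -/
theorem lieGramDetC_pos_iff {ι : Type} [Fintype ι] [DecidableEq ι] (B : Basis ι ℝ (skewC N Jw)) :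
    0 < lieGramDetC N Jw ↔ 0 < (lieGramC B).det := by
  obtain ⟨c, hc, h⟩ := exists_lieGramDetC_eq_sq_mul B
  have hc2 : 0 < c ^ 2 := by positivity
  rw [h]
  exact mul_pos_iff_of_pos_left hc2

/-- The SIGN of the Gram determinant of record is read off any basis: `lieGramDetC < 0 ↔ det Gram(B) < 0`. [cite: Knapp2002, VIII §2] -/
theorem lieGramDetC_neg_iff {ι : Type} [Fintype ι] [DecidableEq ι] (B : Basis ι ℝ (skewC N Jw)) :
    lieGramDetC N Jw < 0 ↔ (lieGramC B).det < 0 := by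
  obtain ⟨c, hc, h⟩ := exists_lieGramDetC_eq_sq_mul B
  have hc2 : 0 < c ^ 2 := by positivity
  rw [h, ← neg_pos, ← mul_neg, mul_pos_iff_of_pos_left hc2, neg_pos]

end Generic

/-! ## §2 `N = 1`: `𝔲(Jw) = iℝ · 1`, Gram `(−1)`, `λ = dt` -/

section One

variable {Jw : Matrix (Fin 1) (Fin 1) ℂ}

/-- **`Re tr((i·1)(i·1)) = −1`** — the `1 × 1` Gram matrix of the coordinate basis `{i·1}` of `𝔲(Jw)`, `N = 1`. [cite: Macdonald1980, p. 93] [cite: Knapp2002, I §1] -/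
theorem traceFormC_I_smul_one :
    traceFormC 1 (I • (1 : Matrix (Fin 1) (Fin 1) ℂ)) (I • (1 : Matrix (Fin 1) (Fin 1) ℂ)) = -1 := by
  rw [traceFormC_apply, Matrix.smul_mul, Matrix.one_mul, Matrix.trace_smul, Matrix.trace_smul, Matrix.trace_one, Fintype.card_fin, Nat.cast_one,
    smul_eq_mul, smul_eq_mul, mul_one, I_mul_I, neg_re, one_re]

/-- The coordinate basis `{i·1}` of `𝔲(Jw)` (`Jw` invertible `1 × 1`), as an existence statement: a basis `b` indexed by `Fin 1` with `b 0 = i·1`, Gram determinant `−1`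
(for every `DecidableEq` instance — ★ `lieStdLebesgueC_eq_smul_addHaar` carries the classical one), whose `addHaar` is `dt` pushed along `t ↦ t·(i·1)`.
[cite: Knapp2002, I §1] [cite: Macdonald1980, p. 93] -/
theorem exists_basis_one [MeasurableSpace (skewC 1 Jw)] [BorelSpace (skewC 1 Jw)] (hJ : IsUnit Jw.det) :
    ∃ b : Basis (Fin 1) ℝ (skewC 1 Jw),
      (∀ i, ((b i : skewC 1 Jw) : Matrix (Fin 1) (Fin 1) ℂ) = I • (1 : Matrix (Fin 1) (Fin 1) ℂ)) ∧
      (∀ inst : DecidableEq (Fin 1), @Matrix.det (Fin 1) inst _ ℝ _ (lieGramC b) = -1) ∧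
      b.addHaar = Measure.map (fun t : ℝ => (⟨t • (I • (1 : Matrix (Fin 1) (Fin 1) ℂ)), (skewC 1 Jw).smul_mem t I_smul_one_mem_skewC_one⟩ : skewC 1 Jw)) volume := by
  haveI : FiniteDimensional ℝ (Matrix (Fin 1) (Fin 1) ℂ) := finiteDimensional_matrixC
  set E : skewC 1 Jw := ⟨I • (1 : Matrix (Fin 1) (Fin 1) ℂ), I_smul_one_mem_skewC_one⟩ with hE
  have hE00 : ((E : Matrix (Fin 1) (Fin 1) ℂ) 0 0) = I := by
    rw [hE]; simp only [Matrix.smul_apply, Matrix.one_apply_eq, smul_eq_mul, mul_one]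
  let φₗ : ℝ ≃ₗ[ℝ] skewC 1 Jw :=
    { toFun := fun t => t • E
      map_add' := fun a b => add_smul a b E
      map_smul' := fun a b => by rw [smul_eq_mul, mul_smul]; rfl
      invFun := fun X => ((X : Matrix (Fin 1) (Fin 1) ℂ) 0 0).im
      left_inv := fun t => by
        show (((t • E : skewC 1 Jw) : Matrix (Fin 1) (Fin 1) ℂ) 0 0).im = t
        rw [Submodule.coe_smul, Matrix.smul_apply, hE00, real_smul, im_ofReal_mul, I_im, mul_one]
      right_inv := fun X => by
        apply Subtype.ext
        rw [Submodule.coe_smul]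
        exact (eq_im_smul_of_mem_skewC_one hJ X.2).symm }
  let φ : ℝ ≃L[ℝ] skewC 1 Jw := φₗ.toContinuousLinearEquiv
  set b : Basis (Fin 1) ℝ (skewC 1 Jw) := (Basis.singleton (Fin 1) ℝ).map φₗ with hb
  have hb0 : ∀ i, b i = E := by
    intro i
    rw [hb, Basis.map_apply, Basis.singleton_apply]
    show (1 : ℝ) • E = E
    rw [one_smul]
  refine ⟨b, fun i => by rw [hb0], ?_, ?_⟩
  · intro inst
    obtain rfl : inst = instDecidableEqFin 1 := Subsingleton.elim _ _
    rw [Matrix.det_fin_one, lieGramC_apply, hb0]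
    exact traceFormC_I_smul_one
  · have hvol : (Basis.singleton (Fin 1) ℝ).addHaar = (volume : Measure ℝ) := by
      rw [Basis.addHaar_eq_iff, Basis.coe_parallelepiped]
      have hP : parallelepiped (Basis.singleton (Fin 1) ℝ) = Set.Icc (0 : ℝ) 1 := by
        ext x
        rw [mem_parallelepiped_iff, Set.mem_Icc]
        constructor
        · rintro ⟨t, ht, rfl⟩
          rw [Fin.sum_univ_one, Basis.singleton_apply, smul_eq_mul, mul_one]
          exact ⟨ht.1 0, ht.2 0⟩
        · rintro ⟨h0, h1⟩
          refine ⟨fun _ => x, ⟨fun _ => h0, fun _ => h1⟩, ?_⟩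
          rw [Fin.sum_univ_one, Basis.singleton_apply, smul_eq_mul, mul_one]
      rw [hP, Real.volume_Icc, sub_zero, ENNReal.ofReal_one]
    have hmap : b.addHaar = (volume : Measure ℝ).map φ := by
      rw [← hvol, Basis.map_addHaar _ φ, hb]
      rfl
    rw [hmap]
    rfl

/-- **`N = 1`: THE GRAM DETERMINANT OF RECORD IS NEGATIVE** (`= −c²`): the trace form on the line `𝔲(Jw) = iℝ·1` is negative definite. [cite: Knapp2002, I §1] [cite: Macdonald1980, p. 93] -/
theorem lieGramDetC_one_neg (hJ : IsUnit Jw.det) : lieGramDetC 1 Jw < 0 := by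
  letI : MeasurableSpace (skewC 1 Jw) := borel _
  haveI : BorelSpace (skewC 1 Jw) := ⟨rfl⟩
  obtain ⟨b, -, hdet, -⟩ := exists_basis_one (Jw := Jw) hJ
  rw [lieGramDetC_neg_iff b, hdet]
  norm_num

/-- **`N = 1`: THE TOP-FORM LEBESGUE MEASURE OF `𝔲(Jw)` IS `dt`** in the coordinate `t ↦ t·(i·1)` (`√|−1| = 1`; ★ `lieStdLebesgueC_eq_smul_addHaar`).
[cite: Macdonald1980, p. 93] [cite: Rogawski1990, §1.7 p. 6] -/
theorem lieStdLebesgueC_one_eq_map [MeasurableSpace (skewC 1 Jw)] [BorelSpace (skewC 1 Jw)] (hJ : IsUnit Jw.det) :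
    lieStdLebesgueC 1 Jw =
      Measure.map (fun t : ℝ => (⟨t • (I • (1 : Matrix (Fin 1) (Fin 1) ℂ)), (skewC 1 Jw).smul_mem t I_smul_one_mem_skewC_one⟩ : skewC 1 Jw)) volume := by
  obtain ⟨b, -, hdet, hmap⟩ := exists_basis_one (Jw := Jw) hJ
  rw [lieStdLebesgueC_eq_smul_addHaar b, hdet, abs_neg, abs_one, Real.sqrt_one, ENNReal.ofReal_one, one_smul, hmap]

end One

/-! ## §3 `N = 2`, `Jw = 1₂` (definite): Gram `diag(−1,−1,−2,−2)`, det `4`, `λ = 2 · da db dz` -/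

section TwoOne

/-- **The trace form of `𝔲(2)` in coordinates**: `Re tr(!![ia, z; −z̄, ib] · !![ia′, z′; −z̄′, ib′]) = −(aa′ + bb′ + 2 Re(z z̄′))` — so the coordinate basis
`diag(i,0), diag(0,i), !![0,1;−1,0], !![0,i;i,0]` has Gram matrix `diag(−1,−1,−2,−2)`, determinant `4`. [cite: Macdonald1980, p. 93] [cite: Knapp2002, I §1] -/
theorem traceFormC_coord_two_one (a b a' b' : ℝ) (z z' : ℂ) :
    traceFormC 2 !![(a : ℂ) * I, z; -conj z, (b : ℂ) * I] !![(a' : ℂ) * I, z'; -conj z', (b' : ℂ) * I] =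
      -(a * a' + b * b' + 2 * (z.re * z'.re + z.im * z'.im)) := by
  rw [traceFormC_apply, Matrix.trace_fin_two]
  simp [Matrix.mul_apply, Fin.sum_univ_two, Complex.mul_re, Complex.mul_im]
  ring

/-- The coordinate basis of `𝔲(2) = 𝔲(1₂)`, as an existence statement: a basis `B` indexed by `(Fin 1 ⊕ Fin 1) ⊕ Fin 2` (`a`, `b`, `Re z`, `Im z`) with Gram determinant `4`
(for every `DecidableEq` instance) whose `addHaar` is `da db dz` pushed along `ψ : (a,b,z) ↦ !![ia, z; −z̄, ib]` (the construction inside ★ `lintegral_cayleyWeightC_two`, exported).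
[cite: Knapp2002, I §1] [cite: Macdonald1980, p. 93] -/
theorem exists_basis_two_one [MeasurableSpace (skewC 2 (1 : Matrix (Fin 2) (Fin 2) ℂ))] [BorelSpace (skewC 2 (1 : Matrix (Fin 2) (Fin 2) ℂ))] :
    ∃ B : Basis ((Fin 1 ⊕ Fin 1) ⊕ Fin 2) ℝ (skewC 2 (1 : Matrix (Fin 2) (Fin 2) ℂ)),
      (∀ inst : DecidableEq ((Fin 1 ⊕ Fin 1) ⊕ Fin 2), @Matrix.det _ inst _ ℝ _ (lieGramC B) = 4) ∧
      B.addHaar = Measure.map (fun p : (ℝ × ℝ) × ℂ =>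
        (⟨!![(p.1.1 : ℂ) * I, p.2; -conj p.2, (p.1.2 : ℂ) * I], mem_skewC_two_one p.1.1 p.1.2 p.2⟩ : skewC 2 (1 : Matrix (Fin 2) (Fin 2) ℂ))) volume := by
  haveI : FiniteDimensional ℝ (Matrix (Fin 2) (Fin 2) ℂ) := finiteDimensional_matrixC
  -- the coordinate `ψ : (ℝ × ℝ) × ℂ ≃L[ℝ] 𝔲(2)` (as in ★ `lintegral_cayleyWeightC_two`)
  let ψₗ : ((ℝ × ℝ) × ℂ) ≃ₗ[ℝ] skewC 2 (1 : Matrix (Fin 2) (Fin 2) ℂ) :=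
    { toFun := fun p => ⟨!![(p.1.1 : ℂ) * I, p.2; -conj p.2, (p.1.2 : ℂ) * I], mem_skewC_two_one p.1.1 p.1.2 p.2⟩
      map_add' := fun p q => by
        apply Subtype.ext
        ext i j
        fin_cases i <;> fin_cases j <;> simp <;> ring
      map_smul' := fun t p => by
        apply Subtype.ext
        ext i j
        fin_cases i <;> fin_cases j <;> simp [Complex.real_smul, Complex.conj_ofReal] <;> ring
      invFun := fun X => ((((X : Matrix (Fin 2) (Fin 2) ℂ) 0 0).im, ((X : Matrix (Fin 2) (Fin 2) ℂ) 1 1).im),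
        (X : Matrix (Fin 2) (Fin 2) ℂ) 0 1)
      left_inv := fun p => by
        ext <;> simp
      right_inv := fun X => by
        apply Subtype.ext
        exact (eq_of_mem_skewC_two_one X.2).symm }
  let ψ : ((ℝ × ℝ) × ℂ) ≃L[ℝ] skewC 2 (1 : Matrix (Fin 2) (Fin 2) ℂ) := ψₗ.toContinuousLinearEquiv
  have hψ : ∀ p : (ℝ × ℝ) × ℂ, (ψ p : Matrix (Fin 2) (Fin 2) ℂ) = !![(p.1.1 : ℂ) * I, p.2; -conj p.2, (p.1.2 : ℂ) * I] :=
    fun _ => rfl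
  -- the coordinate basis
  set s₁ : Basis (Fin 1) ℝ ℝ := (OrthonormalBasis.singleton (Fin 1) ℝ).toBasis with hs₁
  set cI : Basis (Fin 2) ℝ ℂ := Complex.orthonormalBasisOneI.toBasis with hcI
  set bV : Basis ((Fin 1 ⊕ Fin 1) ⊕ Fin 2) ℝ ((ℝ × ℝ) × ℂ) := (s₁.prod s₁).prod cI with hbV
  have hs₁v : s₁.addHaar = volume := (OrthonormalBasis.singleton (Fin 1) ℝ).addHaar_eq_volume
  have hcIv : cI.addHaar = volume := Complex.orthonormalBasisOneI.addHaar_eq_volume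
  have hbVv : bV.addHaar = volume := by
    rw [hbV, Basis.prod_addHaar, Basis.prod_addHaar, hs₁v, hcIv, ← Measure.volume_eq_prod, ← Measure.volume_eq_prod]
  have hs₁a : ∀ i, s₁ i = 1 := fun i => by
    rw [hs₁, OrthonormalBasis.coe_toBasis, OrthonormalBasis.singleton_apply]
  have hcI0 : cI 0 = 1 := by rw [hcI, Complex.toBasis_orthonormalBasisOneI, Complex.coe_basisOneI]; rfl
  have hcI1 : cI 1 = I := by rw [hcI, Complex.toBasis_orthonormalBasisOneI, Complex.coe_basisOneI]; rfl
  set B : Basis ((Fin 1 ⊕ Fin 1) ⊕ Fin 2) ℝ (skewC 2 (1 : Matrix (Fin 2) (Fin 2) ℂ)) := bV.map ψₗ with hB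
  have hB1 : ∀ i, (B (Sum.inl (Sum.inl i)) : Matrix (Fin 2) (Fin 2) ℂ) = !![I, 0; 0, 0] := by
    intro i
    rw [hB, Basis.map_apply]
    show (ψ (bV (Sum.inl (Sum.inl i))) : Matrix (Fin 2) (Fin 2) ℂ) = _
    rw [hψ, hbV, Basis.prod_apply, Sum.elim_inl, Function.comp_apply, Basis.prod_apply, Sum.elim_inl, Function.comp_apply, hs₁a]
    simp
  have hB2 : ∀ i, (B (Sum.inl (Sum.inr i)) : Matrix (Fin 2) (Fin 2) ℂ) = !![0, 0; 0, I] := by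
    intro i
    rw [hB, Basis.map_apply]
    show (ψ (bV (Sum.inl (Sum.inr i))) : Matrix (Fin 2) (Fin 2) ℂ) = _
    rw [hψ, hbV, Basis.prod_apply, Sum.elim_inl, Function.comp_apply, Basis.prod_apply, Sum.elim_inr, Function.comp_apply, hs₁a]
    simp
  have hB3 : (B (Sum.inr 0) : Matrix (Fin 2) (Fin 2) ℂ) = !![0, 1; -1, 0] := by
    rw [hB, Basis.map_apply]
    show (ψ (bV (Sum.inr 0)) : Matrix (Fin 2) (Fin 2) ℂ) = _
    rw [hψ, hbV, Basis.prod_apply, Sum.elim_inr, Function.comp_apply, hcI0]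
    simp
  have hB4 : (B (Sum.inr 1) : Matrix (Fin 2) (Fin 2) ℂ) = !![0, I; I, 0] := by
    rw [hB, Basis.map_apply]
    show (ψ (bV (Sum.inr 1)) : Matrix (Fin 2) (Fin 2) ℂ) = _
    rw [hψ, hbV, Basis.prod_apply, Sum.elim_inr, Function.comp_apply, hcI1]
    simp
  refine ⟨B, ?_, ?_⟩
  · -- Gram matrix `diag(−1,−1,−2,−2)`
    intro inst
    have hdiag : lieGramC B = Matrix.diagonal (Sum.elim (Sum.elim (fun _ : Fin 1 => (-1 : ℝ)) (fun _ : Fin 1 => -1)) ![-2, -2]) := by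
      ext i j
      rw [lieGramC_apply, traceFormC_apply]
      rcases i with ((i | i) | i) <;> rcases j with ((j | j) | j)
      all_goals fin_cases i <;> fin_cases j
      all_goals norm_num [hB1, hB2, hB3, hB4, Matrix.trace_fin_two, Matrix.diagonal, Sum.inl_ne_inr, Sum.inr_ne_inl]
    rw [hdiag, Matrix.det_diagonal]
    norm_num
  · have hmap : B.addHaar = (volume : Measure ((ℝ × ℝ) × ℂ)).map ψ := by
      rw [← hbVv, Basis.map_addHaar _ ψ, hB]
      rfl
    rw [hmap]
    rfl

/-- **`N = 2`, `Jw = 1₂`: THE GRAM DETERMINANT OF RECORD IS POSITIVE** (`= 4c²`; two negative diagonal directions and a negative-definite plane: `(−1)² = +1`).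
[cite: Knapp2002, I §1] [cite: Macdonald1980, p. 93] -/
theorem lieGramDetC_two_one_pos : 0 < lieGramDetC 2 (1 : Matrix (Fin 2) (Fin 2) ℂ) := by
  letI : MeasurableSpace (skewC 2 (1 : Matrix (Fin 2) (Fin 2) ℂ)) := borel _
  haveI : BorelSpace (skewC 2 (1 : Matrix (Fin 2) (Fin 2) ℂ)) := ⟨rfl⟩
  obtain ⟨B, hdet, -⟩ := exists_basis_two_one
  rw [lieGramDetC_pos_iff B, hdet inferInstance]
  norm_num

/-- **`N = 2`, `Jw = 1₂`: THE TOP-FORM LEBESGUE MEASURE OF `𝔲(2)` IS `2 · da db dz`** in the coordinates `(a, b, z) ↦ !![ia, z; −z̄, ib]` (`√|4| = 2`;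
★ `lieStdLebesgueC_eq_smul_addHaar`) — the factor `2 = 2^{N(N−1)∕2}` per complex place that socket F9 carries for `𝔲(h)_w` definite.
[cite: Macdonald1980, p. 93] [cite: Rogawski1990, §1.7 p. 6] -/
theorem lieStdLebesgueC_two_one_eq [MeasurableSpace (skewC 2 (1 : Matrix (Fin 2) (Fin 2) ℂ))] [BorelSpace (skewC 2 (1 : Matrix (Fin 2) (Fin 2) ℂ))] :
    lieStdLebesgueC 2 (1 : Matrix (Fin 2) (Fin 2) ℂ) =
      ENNReal.ofReal 2 • Measure.map (fun p : (ℝ × ℝ) × ℂ =>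
        (⟨!![(p.1.1 : ℂ) * I, p.2; -conj p.2, (p.1.2 : ℂ) * I], mem_skewC_two_one p.1.1 p.1.2 p.2⟩ : skewC 2 (1 : Matrix (Fin 2) (Fin 2) ℂ))) volume := by
  obtain ⟨B, hdet, hmap⟩ := exists_basis_two_one
  rw [lieStdLebesgueC_eq_smul_addHaar B, hdet, hmap]
  norm_num

end TwoOne

end Summit.HodgeConjecture.HodgeConjecture.Cruxes.H413.K2E5LieGramDetValue

end
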